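import Summits.BirchSwinnertonDyer.BirchSwinnertonDyer.Theses.CMKolyvaginAtInertTwo
import Summits.BirchSwinnertonDyer.BirchSwinnertonDyer.Theorems.CMKolyvaginAtInertTwoShaCountOfFactsAtTwo
import Summits.BirchSwinnertonDyer.BirchSwinnertonDyer.Theorems.CMKolyvaginAtInertTwoShaCountPairDefectAtTwo
import HarnessLib

/-! Scratch (bsd-line-cmk2-p1 g15): kernel check of a TURNKEY route edit for crux 24277
`CMKolyvaginExactAtInertTwo` following KERNEL-STATUS §13.4/§14: (1) restrict the Heegner field to
PRIME `|d_K|` (the count identity of §14 — and g10's `g = 1` — need it; composite `d_K` picks up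
`2^{g−1}`); (2) give the crux an `…OfFacts` twin on the route's four published inputs (as for
22837/24154); (3) reduce it BY NAME to ONE statement about the PAIR `(E, E^{(d_K)})` over `ℚ`,
`CMKolyvaginPairCountAtInertTwo` — the statement the `p = 2` pair telescope (≤, g13–g14 kernel,
T2 inputs pending) and McCallum's Prop. 5.2 at `2` (≥, T3) are to deliver. The reduction
`pairCount → ofFactsPrime` is the theorem `cmKolyvaginExactAtInertTwoPrimeOfFacts_of_pairCount`
below (kernel-checked here, axioms standard, no sorry). Nothing is asserted about the crux itself;
BSD is not proved by any of this.

**v2 (g15, ~06:15Z) — NO RESTATEMENT NEEDED.** Files XIV–XVII of the count identity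
(`…ShaCountCompositeTwistAtTwo`, `…ShaCountCompositeAtTwo`, `…ShaCountJacobiCompositeAtTwo`,
`…ShaCountPairDefectAtTwo`) prove the bridge for EVERY odd `d_K`:
`#Ш(E_K)[2^∞]·2 = n_E·#Ш(E)[2^∞]·#Ш(E^{(d_K)})[2^∞]·2^{Σ_{q ∣ d_K}([(Δ/q)=−1] + 2[(Δ/q)=1 ∧ a_q even])}`.
So the pen may keep 24277 VERBATIM and add only: (2′) its `…OfFacts` twin
`CMKolyvaginExactAtInertTwoOfFacts` and (3′) the PAIR-WITH-DEFECT crux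
`CMKolyvaginPairDefectCountAtInertTwo` (binders of 24277 verbatim, conclusion
`n_E · #Ш(W)[2^∞] · #Ш(W^{(d_K)})[2^∞] · 2^{Σ} = 2^{2M₀+1}`), with the by-name reduction
`cmKolyvaginExactAtInertTwoOfFacts_of_pairDefectCount` below. On H₂ (`Δ < 0`, so `n_E = 1`) with
prime `|d_K| = q` the defect is `Σ = 1` (`(Δ/q) = −1`, file X) and (3′) is (3); for composite `d_K`
the defect is `≥ 1` (file XVI) and explicit. The v1 proposal (prime `|d_K|`) remains valid. -/

namespace Scratch.CMKolyvaginAtInertTwoEdit24277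

open Summit.BirchSwinnertonDyer.BirchSwinnertonDyer.Theses.CMKolyvaginAtInertTwo
open Summit.BirchSwinnertonDyer.BirchSwinnertonDyer.Theorems

/-- PROPOSED crux text (24277′): `CMKolyvaginExactAtInertTwo` VERBATIM with ONE extra binder,
`Nat.Prime (NumberField.discr K).natAbs`, inserted after `NumberField.discr K ≠ -3`. -/
def CMKolyvaginExactAtInertTwoPrime : Prop :=
  ∀ (W : WeierstrassCurve ℚ) [W.IsElliptic] [W.IsGloballyMinimal] [NeZero (W.conductorNorm ℤ)], W.HasCM → Literature.NumberTheory.EllipticCurves.Rank1Residual.CMInert W 2 → W.HasSurjectiveModNGaloisRep (2 : ℤ) → Odd W.tamagawaProduct → ∀ (K : Type) [Field K] [NumberField K], Literature.NumberTheory.EllipticCurves.IsImaginaryQuadratic K → Odd (NumberField.discr K) → NumberField.discr K ≠ -3 → Nat.Prime (NumberField.discr K).natAbs → Literature.NumberTheory.EllipticCurves.SatisfiesHeegnerHypothesis (W.conductorNorm ℤ) K → ¬ IsSquare ((NumberField.discr K : ℚ) * -|W.Δ|) → ¬ IsSquare ((NumberField.discr K : ℚ) * (-(2 * |W.Δ|)))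 → ∀ (Dt : Literature.NumberTheory.EllipticCurves.ModularForms.ModularParametrizationData W (W.conductorNorm ℤ)) (β : ℤ) (ι : K →+* ℂ) (d₁ : Literature.NumberTheory.EllipticCurves.KolyvaginHeegnerData Dt β ι 1), ¬ IsOfFinAddOrder d₁.derivedPoint → ∀ (M₀ : ℕ), (∃ Q : (W.baseChange (Literature.NumberTheory.EllipticCurves.ringClassField K ι 1)).toAffine.Point, ((2 ^ M₀ : ℕ) : ℤ) • Q = d₁.derivedPoint) → (¬ ∃ Q : (W.baseChange (Literature.NumberTheory.EllipticCurves.ringClassField K ι 1)).toAffine.Point, ((2 ^ (M₀ + 1) : ℕ) : ℤ) • Q = d₁.derivedPoint) → ∀ (n : ℕ) (d : Literature.NumberTheory.EllipticCurves.KolyvaginHeegnerData Dt β ι n), Squarefree n → (∀ ℓ ∈ n.primeFactors, (Literature.NumberTheory.EllipticCurves.Zhang2014.IsKolyvaginPrime (W.conductorNorm ℤ) W K 2 ℓ ∧ Literature.NumberTheory.EllipticCurves.Rank1Residual.CMInert W ℓ)) → (¬ ∃ Q : (W.baseChange (Literature.NumberTheory.EllipticCurves.ringClassField K ι n)).toAffine.Point,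 (2 : ℤ) • Q = d.derivedPoint) → Nat.card (AddCommGroup.primaryComponent (W.baseChange K).sha 2) = 2 ^ (2 * M₀)

/-- PROPOSED `…OfFacts` twin of 24277′ on the route's four published inputs (items 24148, 19921,
19273, 24149), the shape of 24154 `CMExactDescentAtTwoOfFacts`. -/
def CMKolyvaginExactAtInertTwoPrimeOfFacts : Prop :=
  ((∀ (N : ℕ) [NeZero N] (W : WeierstrassCurve ℚ) (K : Type) [Field K] [NumberField K],
      Literature.NumberTheory.EllipticCurves.gross_zagier N W K) ∧
    Literature.NumberTheory.EllipticCurves.rank_eq_analyticRank_of_analyticRank_le_one ∧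
    WeierstrassCurve.hasEntireLFunction_rat ∧
    Literature.NumberTheory.EllipticCurves.Milne1972.bsdQuotient_baseChange_quadratic_anyModel) →
  CMKolyvaginExactAtInertTwoPrime

/-- PROPOSED new crux (the PAIR COUNT over `ℚ`): the binders of 24277′ VERBATIM, conclusion
`#Ш(E/ℚ)[2^∞] · #Ш(E^{(d_K)}/ℚ)[2^∞] = 2^{2M₀}` — the statement the `p = 2` pair telescope (≤) and
McCallum Prop. 5.2 at `2` (≥) prove (KERNEL-STATUS §14.2). -/
def CMKolyvaginPairCountAtInertTwo : Prop :=
  ∀ (W : WeierstrassCurve ℚ) [W.IsElliptic] [W.IsGloballyMinimal] [NeZero (W.conductorNorm ℤ)], W.HasCM → Literature.NumberTheory.EllipticCurves.Rank1Residual.CMInert W 2 → W.HasSurjectiveModNGaloisRep (2 : ℤ) → Odd W.tamagawaProduct → ∀ (K : Type) [Field K] [NumberField K], Literature.NumberTheory.EllipticCurves.IsImaginaryQuadratic K → Odd (NumberField.discr K) → NumberField.discr K ≠ -3 → Nat.Prime (NumberField.discr K).natAbs → Literature.NumberTheory.EllipticCurves.SatisfiesHeegnerHypothesis (W.conductorNorm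 ℤ) K → ¬ IsSquare ((NumberField.discr K : ℚ) * -|W.Δ|) → ¬ IsSquare ((NumberField.discr K : ℚ) * (-(2 * |W.Δ|))) → ∀ (Dt : Literature.NumberTheory.EllipticCurves.ModularForms.ModularParametrizationData W (W.conductorNorm ℤ)) (β : ℤ) (ι : K →+* ℂ) (d₁ : Literature.NumberTheory.EllipticCurves.KolyvaginHeegnerData Dt β ι 1), ¬ IsOfFinAddOrder d₁.derivedPoint → ∀ (M₀ : ℕ), (∃ Q : (W.baseChange (Literature.NumberTheory.EllipticCurves.ringClassField K ι 1)).toAffine.Point, ((2 ^ M₀ : ℕ) : ℤ) • Q = d₁.derivedPoint) → (¬ ∃ Q : (W.baseChange (Literature.NumberTheory.EllipticCurves.ringClassField K ι 1)).toAffine.Point, ((2 ^ (M₀ + 1) : ℕ) : ℤ) • Q = d₁.derivedPoint) → ∀ (n : ℕ) (d : Literature.NumberTheory.EllipticCurves.KolyvaginHeegnerData Dt β ι n), Squarefree n → (∀ ℓ ∈ n.primeFactors, (Literature.NumberTheory.EllipticCurves.Zhang2014.IsKolyvaginPrime (W.conductorNorm ℤ) W K 2 ℓ ∧ Literature.NumberTheory.EllipticCurves.Rank1Residual.CMInert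 W ℓ)) → (¬ ∃ Q : (W.baseChange (Literature.NumberTheory.EllipticCurves.ringClassField K ι n)).toAffine.Point, (2 : ℤ) • Q = d.derivedPoint) → Nat.card (AddCommGroup.primaryComponent W.sha 2) * Nat.card (AddCommGroup.primaryComponent (W.quadraticTwist (NumberField.discr K : ℚ)).sha 2) = 2 ^ (2 * M₀)

/-- 24277 as filed implies 24277′ (dropping a binder). -/
theorem prime_of_original (h : CMKolyvaginExactAtInertTwo) : CMKolyvaginExactAtInertTwoPrime := by
  intro W _ _ _ hCM hin hsurj hT K _ _ hK hodd h3 _hq hH hns1 hns2 Dt β ι d₁ hy M₀ hdiv hndiv n d hsq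
    hkol hnd
  exact h W hCM hin hsurj hT K hK hodd h3 hH hns1 hns2 Dt β ι d₁ hy M₀ hdiv hndiv n d hsq hkol hnd

/-- **THE BY-NAME REDUCTION (kernel-checked): the pair count implies the `…OfFacts` twin of 24277′**,
by `ShaCountTwo.card_primaryComponent_sha_two_baseChange_eq_pow_of_pair_of_facts` (g15, §14). -/
theorem cmKolyvaginExactAtInertTwoPrimeOfFacts_of_pairCount (hP : CMKolyvaginPairCountAtInertTwo) :
    CMKolyvaginExactAtInertTwoPrimeOfFacts := by
  rintro ⟨hGZ, hGZK, hmod, hMil⟩ W _ _ _ hCM hin hsurj hT K _ _ hK hodd h3 hq hH hns1 hns2 Dt β ι d₁ hy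
    M₀ hdiv hndiv n d hsq hkol hnd
  have hsurj' : W.HasSurjectiveModNGaloisRep 2 := by simpa using hsurj
  exact ShaCountTwo.card_primaryComponent_sha_two_baseChange_eq_pow_of_pair_of_facts hGZ hGZK hmod hMil
    W hCM hin hsurj' K hK hodd hH hq Dt β ι d₁ hy
    (hP W hCM hin hsurj hT K hK hodd h3 hq hH hns1 hns2 Dt β ι d₁ hy M₀ hdiv hndiv n d hsq hkol hnd)


/-! ## v2 — no restatement: the `…OfFacts` twin of 24277 AS FILED and the pair-with-defect crux -/

/-- PROPOSED (v2) `…OfFacts` twin of 24277 AS FILED, on the route's four published inputs (items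
24148, 19921, 19273, 24149). -/
def CMKolyvaginExactAtInertTwoOfFacts : Prop :=
  ((∀ (N : ℕ) [NeZero N] (W : WeierstrassCurve ℚ) (K : Type) [Field K] [NumberField K],
      Literature.NumberTheory.EllipticCurves.gross_zagier N W K) ∧
    Literature.NumberTheory.EllipticCurves.rank_eq_analyticRank_of_analyticRank_le_one ∧
    WeierstrassCurve.hasEntireLFunction_rat ∧
    Literature.NumberTheory.EllipticCurves.Milne1972.bsdQuotient_baseChange_quadratic_anyModel) →
  CMKolyvaginExactAtInertTwo

/-- PROPOSED (v2) new crux, the PAIR-WITH-DEFECT COUNT over `ℚ`: the binders of 24277 VERBATIM,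
conclusion `n_E · #Ш(E/ℚ)[2^∞] · #Ш(E^{(d_K)}/ℚ)[2^∞] · 2^{Σ_{q ∣ d_K}([(Δ/q) = −1] + 2[(Δ/q) = 1 ∧ a_q even])} = 2^{2M₀+1}`
(`n_E = if 0 < Δ then 2 else 1`; on H₂ `Δ < 0`). For prime `|d_K|` on H₂ this is
`#Ш(E)[2^∞]·#Ш(E^{(d_K)})[2^∞]·2 = 2^{2M₀+1}`, i.e. v1's `CMKolyvaginPairCountAtInertTwo`. -/
def CMKolyvaginPairDefectCountAtInertTwo : Prop :=
  ∀ (W : WeierstrassCurve ℚ) [W.IsElliptic] [W.IsGloballyMinimal] [NeZero (W.conductorNorm ℤ)], W.HasCM → Literature.NumberTheory.EllipticCurves.Rank1Residual.CMInert W 2 → W.HasSurjectiveModNGaloisRep (2 : ℤ) → Odd W.tamagawaProduct → ∀ (K : Type) [Field K] [NumberField K], Literature.NumberTheory.EllipticCurves.IsImaginaryQuadratic K → Odd (NumberField.discr K) → NumberField.discr K ≠ -3 → Literature.NumberTheory.EllipticCurves.SatisfiesHeegnerHypothesis (W.conductorNorm ℤ) K → ¬ IsSquare ((NumberField.discr K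 : ℚ) * -|W.Δ|) → ¬ IsSquare ((NumberField.discr K : ℚ) * (-(2 * |W.Δ|))) → ∀ (Dt : Literature.NumberTheory.EllipticCurves.ModularForms.ModularParametrizationData W (W.conductorNorm ℤ)) (β : ℤ) (ι : K →+* ℂ) (d₁ : Literature.NumberTheory.EllipticCurves.KolyvaginHeegnerData Dt β ι 1), ¬ IsOfFinAddOrder d₁.derivedPoint → ∀ (M₀ : ℕ), (∃ Q : (W.baseChange (Literature.NumberTheory.EllipticCurves.ringClassField K ι 1)).toAffine.Point, ((2 ^ M₀ : ℕ) : ℤ) • Q = d₁.derivedPoint) → (¬ ∃ Q : (W.baseChange (Literature.NumberTheory.EllipticCurves.ringClassField K ι 1)).toAffine.Point, ((2 ^ (M₀ + 1) : ℕ) : ℤ) • Q = d₁.derivedPoint) → ∀ (n : ℕ) (d : Literature.NumberTheory.EllipticCurves.KolyvaginHeegnerData Dt β ι n), Squarefree n → (∀ ℓ ∈ n.primeFactors, (Literature.NumberTheory.EllipticCurves.Zhang2014.IsKolyvaginPrime (W.conductorNorm ℤ) W K 2 ℓ ∧ Literature.NumberTheory.EllipticCurves.Rank1Residual.CMInert W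 ℓ)) → (¬ ∃ Q : (W.baseChange (Literature.NumberTheory.EllipticCurves.ringClassField K ι n)).toAffine.Point, (2 : ℤ) • Q = d.derivedPoint) →
    (if 0 < W.Δ then 2 else 1) *
      (Nat.card (AddCommGroup.primaryComponent W.sha 2) *
        Nat.card (AddCommGroup.primaryComponent (W.quadraticTwist (NumberField.discr K : ℚ)).sha 2)) *
      2 ^ ∑ q ∈ (NumberField.discr K).natAbs.primeFactors,
        ((if jacobiSym W.Δ.num q = -1 then 1 else 0) +
          (if jacobiSym W.Δ.num q = 1 ∧ Even (W.frobeniusTrace q) then 2 else 0)) =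
      2 ^ (2 * M₀ + 1)

/-- **THE BY-NAME REDUCTION, v2 (kernel-checked): the pair-with-defect count implies the `…OfFacts`
twin of 24277 AS FILED**, by `ShaCountTwo.card_primaryComponent_sha_two_baseChange_eq_pow_of_pairDefect_of_facts`
(g15, file XVII). The binders `HasCM`, `CMInert W 2`, `Odd ∏c`, `d_K ≠ −3`, the `¬IsSquare`s, the
`M₀`-clauses and the Kolyvagin data are passed through, not used, by the bridge. -/
theorem cmKolyvaginExactAtInertTwoOfFacts_of_pairDefectCount (hP : CMKolyvaginPairDefectCountAtInertTwo) :
    CMKolyvaginExactAtInertTwoOfFacts := by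
  rintro ⟨hGZ, hGZK, hmod, hMil⟩ W _ _ _ hCM hin hsurj hT K _ _ hK hodd h3 hH hns1 hns2 Dt β ι d₁ hy
    M₀ hdiv hndiv n d hsq hkol hnd
  have hsurj' : W.HasSurjectiveModNGaloisRep 2 := by simpa using hsurj
  exact ShaCountTwo.card_primaryComponent_sha_two_baseChange_eq_pow_of_pairDefect_of_facts hGZ hGZK hmod
    hMil W hsurj' K hK hodd hH Dt β ι d₁ hy
    (hP W hCM hin hsurj hT K hK hodd h3 hH hns1 hns2 Dt β ι d₁ hy M₀ hdiv hndiv n d hsq hkol hnd)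

end Scratch.CMKolyvaginAtInertTwoEdit24277
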